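import Summits.BirchSwinnertonDyer.BirchSwinnertonDyer.Theorems.ByReductionTypeAtTwoAdditiveGammaTwistKernelAnyImage
import Summits.BirchSwinnertonDyer.BirchSwinnertonDyer.Theorems.ByReductionTypeAtTwoOrdIsogenyDualMaps
import Literature.NumberTheory.EllipticCurves.Kato2004.DivisibilityInputsTorsionProofs
import Literature.NumberTheory.EllipticCurves.Kato2004.IwasawaInvolutionTwistSelmerProofs
import Literature.NumberTheory.EllipticCurves.Greenberg1999.SelmerCotorsionMultiplicative
import Literature.NumberTheory.EllipticCurves.IwasawaSelmerDualProofs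
import Literature.NumberTheory.EllipticCurves.IwasawaSelmerModuleFiniteProofs
import Literature.NumberTheory.EllipticCurves.LFunctionSmulProofs
import HarnessLib

/-!
# Route ByReductionTypeAtTwo, crux C4″ `AdditivePotMultOverKAtTwo` (stmt-BirchSwinnertonDyer-22618; parent
# `AdditiveRankZeroAtTwo` 19098) — R17, part 1: the TORSION binders of the four split-twist block doors DISCHARGED —
# `X(W/ℚ_∞)` (keys `γ⁻¹` and `γ`, at `W` and at every `ℚ`-isogenous member) is `Λ`-torsion for the ADDITIVE split-twist
# curve `W` from the ONE image-free odd-branch input ALONE (Kato Thm. 17.4 (1) read through the tree's skeleton lemma),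
# and `X(W′/ℚ_∞)` for the multiplicative twist `W′` from Greenberg's Thm. 1.5 (Kato–Rohrlich) BY NAME (theorems only)

Cell `bsd-2adic` (run/shared/lean/pub/bsd-2adic/), seat `bsd-2adic-k4-w3` GEN 5 (explicit unit of director-bsd g16 (309)(7):
«C4″ 22618 narrowed — split-twist reducible + irreducible Kato 12.10 upper half at 2»). After GEN 4 (R16) and t42 GEN 23
(`…AdditiveKatoTransportQuadraticLayer`, p700277) the doors «`ℓ_𝔮(X(W/ℚ_∞)) ≤ ℓ_𝔮(Λ/(L̃))` at every height-one `𝔮 ∌ 2`»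
for the four split-twist potentially-multiplicative blocks of C4″ carry, besides `Kato2004.thm12_4`, Greenberg's Thm. 1.14
×2 (PRINT) and the ONE typed input `KatoOddBranchInputsAtTwoNegOneSplitTwistPrintExactAnyImage`, the binders
«`X(W′/ℚ_∞)` torsion» (`hD₀'`, `W′` the multiplicative twist) and «`X(W/ℚ_∞)` torsion» (`hD₀`, `W` the additive curve) —
they feed Greenberg's `ι`-symmetry through `AddKatoTwoQuadLayer.isTorsion_model_iff`. This file DISCHARGES both:

* §0 `selmerDualData_isTorsion_of_inv`: torsion passes from a key-`γ⁻¹` dual Selmer datum to a key-`γ` one (twin of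
  `Kato2004.selmerDualData_isTorsion_inv`, any number field, any `p`).
* §1 (−1)-block: `isTorsion_selmerDualContra_of_oddBranchInputsPrintExactAnyImage` (key `γ⁻¹`),
  `isTorsion_selmerDual_of_oddBranchInputsPrintExactAnyImage` (key `γ`), `…_of_isIsogenous` (every `W₁ ∼_ℚ W`, key `γ`):
  `X` is `Λ`-torsion for `W` globally minimal, additive with `W^{(−1)}` split multiplicative at `2`, from the ONE input and
  `L⁻ ≠ 0` (or an integral door multiple `L̃ = 2^m L⁻ ≠ 0`) — NO `thm12_4`, NO image hypothesis, NO Greenberg, NO `hdec`: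
  the input's §17.13 package has `𝐇²` torsion (Thm. 12.4 (1) is a FIELD of the package), `col` injective and
  `G = 2ⁿ·ι(5T+4)·L⁻ ≠ 0` in `col(loc Z)`, so Kato's proof of Thm. 17.4 (1) (the tree's `Kato2004.isTorsion_of_skeleton_upTo`,
  packaged as `Kato2004.MultDivisibilityInputsContra.isTorsion_X`) applies verbatim at `p = 2`.
* §2 (−2)-block twins (input `KatoOddBranchInputsAtTwoNegTwoSplitTwistPrintExactAnyImage`, `L⁻₂` the `ω·χ₂`-branch), and
  `…_of_negOne`: the same from the ONE `(−1)` input through R15 (`AddKatoTwoGammaTwist.katoOddBranchInputsNegTwoPrintExactAnyImage_of_negOne`).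
* §3 the twist side: `isTorsion_selmerDual_twistModel_of_thm15` — for `W′` globally minimal, multiplicative at `2`, with
  `V • W = W′^{(d)}` and `f` a newform of `W^{(d)}`: `X(W′/ℚ_∞)` is torsion, from
  `Greenberg1999.thm15_isTorsion_multiplicative_rat` (LNM 1716 Thm. 1.5, Kato–Rohrlich, PRINT at every `p`) BY NAME
  (`W′ ≅_ℚ W^{(d)}`, so `f` is a newform of `W′`: `quadraticTwist_smul`, `quadraticTwist_quadraticTwist`,
  `exists_variableChange_quadraticTwist_mul_sq`, `exists_variableChange_quadraticTwist_one`, `LFunction_smul`).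

HONEST FRAMING (D-0036 / D-0054): theorems only — no definition, no named fact, no instance, no `sorry`; route-independent;
CONDITIONAL on the named typed input (conjecture-grade at `2`) resp. on Greenberg's Thm. 1.5 taken as hypothesis BY NAME;
types-the-object-of (two door binders ↦ {ONE input, PRINT, KERNEL}); closes none; nothing booked; BSD is not proved by any
of this. PARTITION: X5@2 additive potentially-multiplicative block, the four split-twist sub-blocks × `p = 2`.

References: [Kato2004Asterisque] Thm. 12.4 (1) (p. 221), Thm. 16.2, 16.6 (pp. 269–271), Thm. 17.4 (1) (p. 273), §17.13
(pp. 279–280), 14.9 (p. 239); [GreenbergLNM1716] Thm. 1.5 (p. 61), §1 (p. 60); [Greenberg1989] pp. 101–102 (`S^ι`);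
[GreenbergVatsal2000] §2 (p. 28); [SilvermanAEC2009] X.5 Cor. 5.4, App. C §16; memo
`run/shared/lean/pub/bsd-2adic/k4w3/gen4/VERDICT-22618-k4w3-GEN4.md`.
-/

set_option autoImplicit false
-- the summit's namespace `Summit.BirchSwinnertonDyer.BirchSwinnertonDyer` (Sub = Summit) trips `dupNamespace`
set_option linter.dupNamespace false

noncomputable section

open scoped Classical MatrixGroups ModularForm

open Field CongruenceSubgroup WeierstrassCurve Literature.NumberTheory.EllipticCurves
  Literature.NumberTheory.EllipticCurves.ModularForms Literature.NumberTheory.EllipticCurves.IwasawaAlgebra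
  Literature.NumberTheory.EllipticCurves.Greenberg1999

namespace Summit.BirchSwinnertonDyer.BirchSwinnertonDyer.Theorems.AddKatoTwo

universe u

/-! ## §0 Torsion passes from key `γ⁻¹` to key `γ` -/

/-- **Torsion passes from a key-`γ⁻¹` dual Selmer datum to a key-`γ` one** (twin of `Kato2004.selmerDualData_isTorsion_inv`):
the `ι`-twist of `D'` is a key-`γ` datum `D₁` with an `ι`-semilinear `D'.X ≃+ D₁.X` (`Kato2004.selmerDualData_exists_involTwist`
for `γ⁻¹·γ = 1`), torsion by `Kato2004.isTorsion_of_involSemilinear`, and `D.X ≃ₗ D₁.X` by uniqueness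
(`SelmerDualData.nonempty_linearEquiv_holds`). [cite: GreenbergLNM1716, §1 (p. 60)] [cite: Greenberg1989, pp. 101–102 (S^ι)] -/
theorem selmerDualData_isTorsion_of_inv {K : Type u} [Field K] [NumberField K] {V : WeierstrassCurve K} {p : ℕ} [Fact p.Prime]
    {κ : ZpExtension K p} {γ : absoluteGaloisGroup K} (D' : V.SelmerDualData κ γ⁻¹) (hD' : D'.IsTorsion)
    (D : V.SelmerDualData κ γ) : D.IsTorsion := by
  obtain ⟨D₁, e, he, -⟩ := Kato2004.selmerDualData_exists_involTwist (inv_mul_cancel γ) D'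
  obtain ⟨e'⟩ := WeierstrassCurve.SelmerDualData.nonempty_linearEquiv_holds D D₁
  have h₁ : Module.IsTorsion (IwasawaAlgebra p) D₁.X := Kato2004.isTorsion_of_involSemilinear hD' e he
  intro x
  obtain ⟨a, ha⟩ := @h₁ (e' x)
  refine ⟨a, ?_⟩
  rw [Submonoid.smul_def] at ha ⊢
  apply e'.injective
  rw [map_smul, map_zero]
  exact ha

/-- `5T + 4 ≠ 0` in `Λ = ℤ₂⟦T⟧` (constant coefficient `4`). [folklore] -/
theorem five_X_add_four_ne_zero : (PowerSeries.C 5 * PowerSeries.X + PowerSeries.C 4 : IwasawaAlgebra 2) ≠ 0 := by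
  intro h
  have h4 := congrArg PowerSeries.constantCoeff h
  simp only [map_add, map_mul, PowerSeries.constantCoeff_C, PowerSeries.constantCoeff_X, mul_zero, zero_add,
    map_zero] at h4
  exact absurd h4 (by norm_num)

/-- `5T + 6 ≠ 0` in `Λ = ℤ₂⟦T⟧` (constant coefficient `6`). [folklore] -/
theorem five_X_add_six_ne_zero : (PowerSeries.C 5 * PowerSeries.X + PowerSeries.C 6 : IwasawaAlgebra 2) ≠ 0 := by
  intro h
  have h6 := congrArg PowerSeries.constantCoeff h
  simp only [map_add, map_mul, PowerSeries.constantCoeff_C, PowerSeries.constantCoeff_X, mul_zero, zero_add,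
    map_zero] at h6
  exact absurd h6 (by norm_num)

/-! ## §1 The (−1)-block: `X(W/ℚ_∞)` is torsion from the ONE image-free input -/

section NegOne

variable (hPE : KatoOddBranchInputsAtTwoNegOneSplitTwistPrintExactAnyImage)
  (W : WeierstrassCurve ℚ) [W.IsElliptic] [W.IsGloballyMinimal] [ContinuousSMul ℤ_[2] (W.tateModule 2)]
  {N : ℕ} [NeZero N] (f : CuspForm (Gamma0 N) 2) (κ : ZpExtension ℚ 2) (γ : absoluteGaloisGroup ℚ)
  (hsp : (W.quadraticTwist (-1)).HasSplitMultiplicativeReductionAtPrime 2)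
  (hκ : κ.IsCyclotomic) (hγ : κ.IsTopGenerator γ) (hγ' : IsCyclotomicVariable 2 γ)
  (hf : IsNewformOf (W.quadraticTwist (-1)) f) (I : Kato2004.IwasawaH1Data W 2 κ γ)

include hPE hsp hκ hγ hγ' hf I in
/-- **`X(W/ℚ_∞)` of key `γ⁻¹` is `Λ`-torsion for the additive (−1)-split-twist curve `W`, from the ONE image-free input and
`L⁻ ≠ 0`** (Kato Thm. 17.4 (1) at `2` read through the package: `Kato2004.MultDivisibilityInputsContra.isTorsion_X`; no
`thm12_4`, no image hypothesis, no Greenberg symmetry, no `hdec`). [cite: Kato2004Asterisque, Thm. 17.4 (1) (p. 273), §17.13 (pp. 279–280), 14.9 (p. 239), Thm. 12.4 (1) (p. 221)] -/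
theorem isTorsion_selmerDualContra_of_oddBranchInputsPrintExactAnyImage (D' : W.SelmerDualData κ γ⁻¹)
    (hL : padicLFunctionMinusBranchMult f (1 : ℚ_[2]) 1 ≠ 0) : D'.IsTorsion := by
  obtain ⟨K, -, -⟩ := hPE W f κ γ hsp hκ hγ hγ' hf I D'
  refine K.isTorsion_X (mul_ne_zero (fun h ↦ five_X_add_four_ne_zero ?_) hL)
  exact iwasawaToPowerSeries_injective 2 (by rw [h, map_zero])

include hPE hsp hκ hγ hγ' hf I in
/-- Door-binder variant of `isTorsion_selmerDualContra_of_oddBranchInputsPrintExactAnyImage`: an integral multiple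
`L̃ = 2^m·L⁻ ≠ 0` (the `(Lt, m, hLt, hLt0)` binders of the lane's doors) replaces `L⁻ ≠ 0`.
[cite: Kato2004Asterisque, Thm. 17.4 (1) (p. 273), Thm. 16.2 (p. 269)] -/
theorem isTorsion_selmerDualContra_of_oddBranchInputsPrintExactAnyImage_of_doorMultiple (D' : W.SelmerDualData κ γ⁻¹)
    (Lt : IwasawaAlgebra 2) (m : ℕ)
    (hLt : iwasawaToPowerSeries 2 Lt = PowerSeries.C ((2 : ℚ_[2]) ^ m) * padicLFunctionMinusBranchMult f (1 : ℚ_[2]) 1)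
    (hLt0 : Lt ≠ 0) : D'.IsTorsion := by
  obtain ⟨K, -, -⟩ := hPE W f κ γ hsp hκ hγ hγ' hf I D'
  have hLt' : iwasawaToPowerSeries 2 Lt =
      PowerSeries.C (((2 : ℕ) : ℚ_[2]) ^ m) * padicLFunctionMinusBranchMult f (1 : ℚ_[2]) 1 := by
    rw [show ((2 : ℕ) : ℚ_[2]) = (2 : ℚ_[2]) by norm_num]; exact hLt
  exact K.isTorsion_X_of_doorMultiple five_X_add_four_ne_zero hLt' hLt0

include hPE hsp hκ hγ hγ' hf I in
/-- **`X(W/ℚ_∞)` of key `γ` is `Λ`-torsion for the additive (−1)-split-twist curve `W`, from the ONE image-free input and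
`L⁻ ≠ 0`** — the key-`γ⁻¹` statement at the `ι`-twist of `D` (`Kato2004.selmerDualData_exists_involTwist`), carried back by
`selmerDualData_isTorsion_of_inv`. This is the binder `hD₀` of `AddKatoTwoQuadLayer.lengthAt_selmerDual*_of_model` (t42 GEN 23).
[cite: Kato2004Asterisque, Thm. 17.4 (1) (p. 273), §17.13 (pp. 279–280)] [cite: GreenbergLNM1716, §1 (p. 60)] -/
theorem isTorsion_selmerDual_of_oddBranchInputsPrintExactAnyImage (D : W.SelmerDualData κ γ)
    (hL : padicLFunctionMinusBranchMult f (1 : ℚ_[2]) 1 ≠ 0) : D.IsTorsion := by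
  obtain ⟨D', -, -, -⟩ := Kato2004.selmerDualData_exists_involTwist (mul_inv_cancel γ) D
  exact selmerDualData_isTorsion_of_inv D'
    (isTorsion_selmerDualContra_of_oddBranchInputsPrintExactAnyImage hPE W f κ γ hsp hκ hγ hγ' hf I D' hL) D

include hPE hsp hκ hγ hγ' hf I in
/-- Door-binder variant of `isTorsion_selmerDual_of_oddBranchInputsPrintExactAnyImage` (`L̃ = 2^m·L⁻ ≠ 0`).
[cite: Kato2004Asterisque, Thm. 17.4 (1) (p. 273), Thm. 16.2 (p. 269)] -/
theorem isTorsion_selmerDual_of_oddBranchInputsPrintExactAnyImage_of_doorMultiple (D : W.SelmerDualData κ γ)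
    (Lt : IwasawaAlgebra 2) (m : ℕ)
    (hLt : iwasawaToPowerSeries 2 Lt = PowerSeries.C ((2 : ℚ_[2]) ^ m) * padicLFunctionMinusBranchMult f (1 : ℚ_[2]) 1)
    (hLt0 : Lt ≠ 0) : D.IsTorsion := by
  obtain ⟨D', -, -, -⟩ := Kato2004.selmerDualData_exists_involTwist (mul_inv_cancel γ) D
  exact selmerDualData_isTorsion_of_inv D'
    (isTorsion_selmerDualContra_of_oddBranchInputsPrintExactAnyImage_of_doorMultiple hPE W f κ γ hsp hκ hγ hγ' hf I D' Lt m
      hLt hLt0) D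

include hPE hsp hκ hγ hγ' hf I in
/-- **`X(W₁/ℚ_∞)` is `Λ`-torsion for every `W₁ ∼_ℚ W`** (the MEMBER form — Kato's member `W_K`, or any curve of the
isogeny class): torsion of `X(W/ℚ_∞)` (`isTorsion_selmerDual_of_oddBranchInputsPrintExactAnyImage` at the tree's constructed
datum `W.selmerDualData κ hγ`) transported along the pseudo-isogeny pair (`IsogenyMuShift.isTorsion_of_isIsogenous`).
[cite: Kato2004Asterisque, Thm. 17.4 (1) (p. 273), §8.3 (p. 181)] [cite: GreenbergVatsal2000, §2 (p. 28)] -/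
theorem isTorsion_selmerDual_of_oddBranchInputsPrintExactAnyImage_of_isIsogenous
    (hL : padicLFunctionMinusBranchMult f (1 : ℚ_[2]) 1 ≠ 0) (W₁ : WeierstrassCurve ℚ) [W₁.IsElliptic]
    (hiso : IsIsogenous W W₁) (D₁ : W₁.SelmerDualData κ γ) : D₁.IsTorsion :=
  IsogenyMuShift.isTorsion_of_isIsogenous hiso (W.selmerDualData κ hγ) D₁
    (isTorsion_selmerDual_of_oddBranchInputsPrintExactAnyImage hPE W f κ γ hsp hκ hγ hγ' hf I (W.selmerDualData κ hγ) hL)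

end NegOne

/-! ## §2 The (−2)-block twins -/

section NegTwo

variable (W : WeierstrassCurve ℚ) [W.IsElliptic] [W.IsGloballyMinimal] [ContinuousSMul ℤ_[2] (W.tateModule 2)]
  {N : ℕ} [NeZero N] (f : CuspForm (Gamma0 N) 2) (κ : ZpExtension ℚ 2) (γ : absoluteGaloisGroup ℚ)
  (hsp : (W.quadraticTwist (-2)).HasSplitMultiplicativeReductionAtPrime 2)
  (hκ : κ.IsCyclotomic) (hγ : κ.IsTopGenerator γ) (hγ' : IsCyclotomicVariable 2 γ)
  (hf : IsNewformOf (W.quadraticTwist (-2)) f) (I : Kato2004.IwasawaH1Data W 2 κ γ)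

include hsp hκ hγ hγ' hf I in
/-- **(−2)-block, key `γ⁻¹`**: `X(W/ℚ_∞)` is `Λ`-torsion for the additive (−2)-split-twist curve `W` from the image-free
`(−2)` input and `L⁻₂ ≠ 0` (`L⁻₂` the `ω·χ₂`-branch `padicLFunctionMinusBranchMultTwist f 1 1 (−1)`).
[cite: Kato2004Asterisque, Thm. 17.4 (1) (p. 273), §17.13 (pp. 279–280), Thm. 16.6 (p. 271)] -/
theorem isTorsion_selmerDualContra_of_oddBranchInputsNegTwoPrintExactAnyImage
    (hPE : KatoOddBranchInputsAtTwoNegTwoSplitTwistPrintExactAnyImage) (D' : W.SelmerDualData κ γ⁻¹)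
    (hL : padicLFunctionMinusBranchMultTwist f (1 : ℚ_[2]) 1 (-1) ≠ 0) : D'.IsTorsion := by
  obtain ⟨K, -, -⟩ := hPE W f κ γ hsp hκ hγ hγ' hf I D'
  refine K.isTorsion_X (mul_ne_zero (fun h ↦ five_X_add_six_ne_zero ?_) hL)
  exact iwasawaToPowerSeries_injective 2 (by rw [h, map_zero])

include hsp hκ hγ hγ' hf I in
/-- **(−2)-block, key `γ`**: `X(W/ℚ_∞)` is `Λ`-torsion for the additive (−2)-split-twist curve `W` from the image-free
`(−2)` input and `L⁻₂ ≠ 0`. [cite: Kato2004Asterisque, Thm. 17.4 (1) (p. 273), §17.13 (pp. 279–280)] [cite: GreenbergLNM1716, §1 (p. 60)] -/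
theorem isTorsion_selmerDual_of_oddBranchInputsNegTwoPrintExactAnyImage
    (hPE : KatoOddBranchInputsAtTwoNegTwoSplitTwistPrintExactAnyImage) (D : W.SelmerDualData κ γ)
    (hL : padicLFunctionMinusBranchMultTwist f (1 : ℚ_[2]) 1 (-1) ≠ 0) : D.IsTorsion := by
  obtain ⟨D', -, -, -⟩ := Kato2004.selmerDualData_exists_involTwist (mul_inv_cancel γ) D
  exact selmerDualData_isTorsion_of_inv D'
    (isTorsion_selmerDualContra_of_oddBranchInputsNegTwoPrintExactAnyImage W f κ γ hsp hκ hγ hγ' hf I hPE D' hL) D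

include hsp hκ hγ hγ' hf I in
/-- **(−2)-block from the ONE `(−1)` input** (R15 in the kernel, ANY image:
`AddKatoTwoGammaTwist.katoOddBranchInputsNegTwoPrintExactAnyImage_of_negOne`): `X(W/ℚ_∞)` of key `γ` is `Λ`-torsion for
the additive (−2)-split-twist curve `W` from `KatoOddBranchInputsAtTwoNegOneSplitTwistPrintExactAnyImage` and `L⁻₂ ≠ 0`.
[cite: Kato2004Asterisque, Thm. 17.4 (1) (p. 273), §17.13 (pp. 279–280)] [cite: MazurTateTeitelbaum1986Invent, §I.13] -/
theorem isTorsion_selmerDual_of_oddBranchInputsPrintExactAnyImage_negTwo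
    (hPE : KatoOddBranchInputsAtTwoNegOneSplitTwistPrintExactAnyImage) (D : W.SelmerDualData κ γ)
    (hL : padicLFunctionMinusBranchMultTwist f (1 : ℚ_[2]) 1 (-1) ≠ 0) : D.IsTorsion :=
  isTorsion_selmerDual_of_oddBranchInputsNegTwoPrintExactAnyImage W f κ γ hsp hκ hγ hγ' hf I
    (AddKatoTwoGammaTwist.katoOddBranchInputsNegTwoPrintExactAnyImage_of_negOne hPE) D hL

include hsp hκ hγ hγ' hf I in
/-- **(−2)-block, MEMBER form**: `X(W₁/ℚ_∞)` is `Λ`-torsion for every `W₁ ∼_ℚ W`, `W` additive (−2)-split-twist, from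
the ONE `(−1)` input and `L⁻₂ ≠ 0`. [cite: Kato2004Asterisque, Thm. 17.4 (1) (p. 273), §8.3 (p. 181)] [cite: GreenbergVatsal2000, §2 (p. 28)] -/
theorem isTorsion_selmerDual_of_oddBranchInputsPrintExactAnyImage_negTwo_of_isIsogenous
    (hPE : KatoOddBranchInputsAtTwoNegOneSplitTwistPrintExactAnyImage)
    (hL : padicLFunctionMinusBranchMultTwist f (1 : ℚ_[2]) 1 (-1) ≠ 0) (W₁ : WeierstrassCurve ℚ) [W₁.IsElliptic]
    (hiso : IsIsogenous W W₁) (D₁ : W₁.SelmerDualData κ γ) : D₁.IsTorsion :=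
  IsogenyMuShift.isTorsion_of_isIsogenous hiso (W.selmerDualData κ hγ) D₁
    (isTorsion_selmerDual_of_oddBranchInputsPrintExactAnyImage_negTwo W f κ γ hsp hκ hγ hγ' hf I hPE
      (W.selmerDualData κ hγ) hL)

end NegTwo

/-! ## §3 The twist side: `X(W′/ℚ_∞)` is torsion for the multiplicative twist, Greenberg Thm. 1.5 BY NAME -/

/-- **A `ℚ`-model `W′` of the twist has the twist's newform**: if `V • W = W′^{(d)}` (`d ≠ 0`) and `f` is a newform of
`W^{(d)}`, then `f` is a newform of `W′` — `W′ ≅_ℚ (W′^{(d)})^{(d)} = (V • W)^{(d)} ≅_ℚ W^{(d)}` (`quadraticTwist_quadraticTwist`,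
`exists_variableChange_quadraticTwist_mul_sq`, `exists_variableChange_quadraticTwist_one`, `quadraticTwist_smul`) and the
`L`-function is a `ℚ`-isomorphism invariant (`LFunction_smul`). [cite: SilvermanAEC2009, X.5 Cor. 5.4, App. C §16] -/
theorem isNewformOf_twistModel (W W' : WeierstrassCurve ℚ) [W.IsElliptic] [W'.IsElliptic] {V : VariableChange ℚ} {d : ℚ}
    (hd : d ≠ 0)
    (hV : V • W = W'.quadraticTwist d) {N : ℕ} [NeZero N] {f : CuspForm (Gamma0 N) 2}
    (hf : IsNewformOf (W.quadraticTwist d) f) : IsNewformOf W' f := by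
  -- `W′^{(1)} = C₁ • W′`, `W′^{(d²)} = C₂ • W′^{(1)}`, `(V • W)^{(d)} = C₃ • W^{(d)}`
  obtain ⟨C₁, hC₁⟩ := W'.exists_variableChange_quadraticTwist_one
  obtain ⟨C₂, hC₂⟩ := W'.exists_variableChange_quadraticTwist_mul_sq 1 d hd
  have htw : (C₂ * C₁) • W' = (⟨V.u, d * V.r, 0, 0⟩ : VariableChange ℚ) • W.quadraticTwist d := by
    rw [mul_smul, hC₁, hC₂, ← quadraticTwist_smul, hV, quadraticTwist_quadraticTwist]
    ring_nf
  haveI : (W.quadraticTwist d).IsElliptic := W.isElliptic_quadraticTwist hd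
  refine ⟨hf.1, fun n ↦ ?_⟩
  rw [hf.2 n, ← LFunction_smul (W.quadraticTwist d) (⟨V.u, d * V.r, 0, 0⟩ : VariableChange ℚ), ← htw, LFunction_smul]

/-- **`X(W′/ℚ_∞)` is `Λ`-torsion for a globally minimal `ℚ`-model `W′` of the twist `W^{(d)}` that is MULTIPLICATIVE at `2`**
(any key `γ` topologically generating the cyclotomic tower), from Greenberg's Thm. 1.5 (Kato–Rohrlich; LNM 1716 p. 61, PRINT
at every prime) BY NAME — the binder `hD₀'` of `AddKatoTwoQuadLayer.lengthAt_selmerDual*_of_model` (t42 GEN 23) for the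
(−1)-block (`d = −1`) and its (−2)-block twin (`d = −2`). [cite: GreenbergLNM1716, Thm. 1.5 (p. 61), §1 (p. 60)]
[cite: SilvermanAEC2009, X.5 Cor. 5.4, App. C §16] -/
theorem isTorsion_selmerDual_twistModel_of_thm15 (h15 : thm15_isTorsion_multiplicative_rat)
    (W W' : WeierstrassCurve ℚ) [W.IsElliptic] [W'.IsElliptic] [W'.IsGloballyMinimal] (hmult' : W'.HasMultiplicativeReductionAtPrime 2)
    {V : VariableChange ℚ} {d : ℚ} (hd : d ≠ 0) (hV : V • W = W'.quadraticTwist d)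
    {N : ℕ} [NeZero N] (f : CuspForm (Gamma0 N) 2) (hf : IsNewformOf (W.quadraticTwist d) f)
    (κ : ZpExtension ℚ 2) (γ : absoluteGaloisGroup ℚ) (hκ : κ.IsCyclotomic) (hγ : κ.IsTopGenerator γ)
    (D₀' : W'.SelmerDualData κ γ) : D₀'.IsTorsion :=
  haveI : Fact (Nat.Prime 2) := ⟨Nat.prime_two⟩
  h15 W' 2 hmult' f (isNewformOf_twistModel W W' hd hV hf) κ γ hκ hγ D₀'

end Summit.BirchSwinnertonDyer.BirchSwinnertonDyer.Theorems.AddKatoTwo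

end
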